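import Summits.NavierStokesRegularity.NavierStokesRegularity.Theorems.AdaptedFrequencyAdaptedFrequencyConvergesStubPinchingUpper
import Summits.NavierStokesRegularity.NavierStokesRegularity.Theorems.AdaptedFrequencyAdaptedFrequencyConvergesStubPinchingLower
import Summits.NavierStokesRegularity.NavierStokesRegularity.Theorems.AdaptedFrequencyAdaptedFrequencyConvergesStubHullTransfer
import Summits.NavierStokesRegularity.NavierStokesRegularity.Theorems.AdaptedFrequencyAdaptedFrequencyConvergesStubKatoL1
import Summits.NavierStokesRegularity.NavierStokesRegularity.Theorems.AdaptedFrequencyAdaptedFrequencyConvergesStubBlockSolver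
import Summits.NavierStokesRegularity.NavierStokesRegularity.Theorems.AdaptedFrequencyAdaptedFrequencyConvergesStubDoeblin
import Literature.Analysis.FluidPDE.TypeIAncientMild
import HarnessLib

/-!
# Crux `AdaptedFrequencyConverges` (stmt-NavierStokesRegularity-10493), line `cloud-frame-effective-tsai`:
  the sharpened hull transfer and the K2 reduction to the MILD hull

Helper file (`--supports` the crux item; lead prover-line-stmt-NavierStokesRegularity-10493-c1-0).
The landed hull transfer `hullTransfer_unit` (`…StubHullTransfer`) outputs a CLASSICAL unit-viscosity
eternal Type-I pair; but the `C²_loc` extraction it rests on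
(`exists_tendsto_of_typeI_oseenMild_windows`) already puts the limit field in the Oseen-mild
Koch–Nadirashvili–Seregin–Šverák class `IsTypeIAncientMild` (smooth on the open slab, divergence
free, `W(t) = e^{(t−s)Δ}W(s) − B¹ₛ(W,W)(t)` between EVERY pair of times, `‖W‖ ≤ C₀/√(−t)`), which has
no Galilei-wobble / parasitic ambiguity. This file records, sorry-free:

* `hullTransfer_mild_unit` — the hull transfer with the MILD conclusion, the kernel uniqueness
  clause (free by kernel uniqueness `adaptedKernel_unique_typeI = stub_doeblin stub_katoL1 stub_blockSolver`,
  all landed), the pinching, `Λ̄(−1) ≠ 2`, and non-constancy of `h̄ = (−τ)² H̄`;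
* `adaptedFrequencyConverges_of_pinchedMildHullHStationary` — **the crux at every viscosity follows
  from h-stationarity of PINCHED UNIT-VISCOSITY Type-I ancient MILD pairs with unique comparable
  kernel** (the sharpened K2 statement): planners may re-line the crux as a Liouville theorem about
  the KNSS class.
-/

noncomputable section

namespace Summit.NavierStokesRegularity.NavierStokesRegularity.Theorems.AdaptedFrequencyConverges.CloudFrameEffectiveTsai

open scoped Topology
open Literature.Analysis Literature.Analysis.FluidPDE Set Filter MeasureTheory Function
open Summit.NavierStokesRegularity.NavierStokesRegularity.Theses.AdaptedFrequency

/-- **Hull transfer to the MILD hull at unit viscosity.** Under the hypotheses of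
`stub_hullTransfer` (Type-I classical Leray–Hopf solution at viscosity `ν`, adapted kernel `G` on
`[t₀, T)` with two-sided Gaussian bounds, two-sided pinching of `(T − t)² H` on `[t₁, T)`, NO limit of
the adapted frequency at `T`), some viscosity-normalised Type-I zoom at `(T, x₀)` along times where
`Λ` stays `ε`-away from `2` converges to: a constant `C₀ ≥ 0`, a unit-viscosity Type-I ancient MILD
field `W ∈ IsTypeIAncientMild C₀` (Oseen/KNSS gauge; it is also classical for some pressure), and an
adapted kernel `K` of `W` on `(−∞,0)` with pole `(0,0)` under the dilated two-sided Gaussian bounds,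
UNIQUE among Gaussian-comparable adapted kernels of `W` (kernel uniqueness for Type-I drifts,
`stub_doeblin stub_katoL1 stub_blockSolver`, i.e. `adaptedKernel_unique_typeI` of `…OfRotatedHull`), with
`c₀ ≤ (−τ)² H̄(τ) ≤ C₁` for all `τ < 0`, `Λ̄(−1) ≠ 2`, and `(−τ)² H̄(τ)` NOT constant. The proof is that
of `hullTransfer_unit`, keeping the mild class delivered by `exists_tendsto_of_typeI_oseenMild_windows`.
[folklore] -/
theorem hullTransfer_mild_unit {ν T : ℝ} (hν : 0 < ν) (hT : 0 < T)
    {u : ℝ → EuclideanSpace ℝ (Fin 3) → EuclideanSpace ℝ (Fin 3)}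
    {p : ℝ → EuclideanSpace ℝ (Fin 3) → ℝ} (hcl : IsClassicalNSSolutionOn (Ico 0 T) ν 0 u p)
    (hLH : IsLerayHopfOn T ν 0 (u 0) u) (hTI : IsTypeIBlowup u T)
    {x₀ : EuclideanSpace ℝ (Fin 3)} {t₀ : ℝ} (ht₀ : t₀ ∈ Ico 0 T)
    {G : ℝ → EuclideanSpace ℝ (Fin 3) → ℝ} (hK : IsAdaptedBackwardKernel ν u (Ico t₀ T) T x₀ G)
    {a₁ a₂ A₁ A₂ : ℝ} (ha₁ : 0 < a₁) (ha₂ : 0 < a₂) (hA₁ : 0 < A₁) (hA₂ : 0 < A₂)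
    (hGb : ∀ t ∈ Ico t₀ T, ∀ x,
      a₁ * (T - t) ^ (-(3:ℝ) / 2) * Real.exp (-(‖x - x₀‖ ^ 2) / (a₂ * (T - t))) ≤ G t x ∧
        G t x ≤ A₁ * (T - t) ^ (-(3:ℝ) / 2) * Real.exp (-(‖x - x₀‖ ^ 2) / (A₂ * (T - t))))
    {t₁ c₀ C₁ : ℝ} (ht₁ : t₁ ∈ Ico t₀ T) (hc₀ : 0 < c₀)
    (hpinch : ∀ t ∈ Ico t₁ T, c₀ ≤ (T - t) ^ 2 * adaptedEnstrophy u G t ∧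
      (T - t) ^ 2 * adaptedEnstrophy u G t ≤ C₁)
    (hnot : ¬ ∃ Λ₀ : ℝ, Tendsto (adaptedFrequency u G T) (𝓝[<] T) (𝓝 Λ₀)) :
    ∃ (C₀ : ℝ) (W : ℝ → EuclideanSpace ℝ (Fin 3) → EuclideanSpace ℝ (Fin 3))
      (K : ℝ → EuclideanSpace ℝ (Fin 3) → ℝ),
      0 ≤ C₀ ∧ IsTypeIAncientMild C₀ W ∧
      (∃ q : ℝ → EuclideanSpace ℝ (Fin 3) → ℝ, IsClassicalNSSolutionOn (Iio 0) 1 0 W q) ∧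
      IsAdaptedBackwardKernel 1 W (Iio 0) 0 0 K ∧
      (∀ t ∈ Iio (0:ℝ), ∀ x,
        (a₁ * ν ^ ((3:ℝ) / 2)) * ((0:ℝ) - t) ^ (-(3:ℝ) / 2) *
            Real.exp (-(‖x - (0 : EuclideanSpace ℝ (Fin 3))‖ ^ 2) / ((a₂ / ν) * ((0:ℝ) - t))) ≤
          K t x ∧
        K t x ≤ (A₁ * ν ^ ((3:ℝ) / 2)) * ((0:ℝ) - t) ^ (-(3:ℝ) / 2) *
            Real.exp (-(‖x - (0 : EuclideanSpace ℝ (Fin 3))‖ ^ 2) / ((A₂ / ν) * ((0:ℝ) - t)))) ∧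
      (∀ K' : ℝ → EuclideanSpace ℝ (Fin 3) → ℝ, IsAdaptedBackwardKernel 1 W (Iio 0) 0 0 K' →
        IsGaussianComparable K' (Iio 0) 0 0 → ∀ t ∈ Iio (0:ℝ), K' t = K t) ∧
      (∀ τ ∈ Iio (0:ℝ), c₀ ≤ (-τ) ^ 2 * adaptedEnstrophy W K τ ∧
        (-τ) ^ 2 * adaptedEnstrophy W K τ ≤ C₁) ∧
      adaptedFrequency W K 0 (-1) ≠ 2 ∧
      ∃ τ₁ τ₂ : ℝ, τ₁ < 0 ∧ τ₂ < 0 ∧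
        (-τ₁) ^ 2 * adaptedEnstrophy W K τ₁ ≠ (-τ₂) ^ 2 * adaptedEnstrophy W K τ₂ := by
  -- a Type-I window
  obtain ⟨Cu, tu, htuT, hI⟩ := exists_window_of_isTypeIBlowup hTI
  -- Step 1: times where `Λ` stays away from `2`
  obtain ⟨ε, tk, hε, htkT, htk, hΛε⟩ := hullTransfer_exists_seq hnot
  -- the scales `c_k = √(ν (T − t_k)) → 0`
  set c : ℕ → ℝ := fun k => Real.sqrt (ν * (T - tk k)) with hcdef
  have hpos : ∀ k, 0 < ν * (T - tk k) := fun k => mul_pos hν (by linarith [htkT k])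
  have hc : ∀ k, 0 < c k := fun k => Real.sqrt_pos.2 (hpos k)
  have hc2 : ∀ k, c k ^ 2 = ν * (T - tk k) := fun k => Real.sq_sqrt (hpos k).le
  have hc0 : Tendsto c atTop (𝓝 0) := by
    have h1 : Tendsto (fun k => ν * (T - tk k)) atTop (𝓝 (ν * (T - T))) :=
      tendsto_const_nhds.mul (tendsto_const_nhds.sub htk)
    rw [sub_self, mul_zero] at h1
    have h2 := h1.sqrt
    rw [Real.sqrt_zero] at h2
    exact h2
  have hzoom1 : ∀ k, T + c k ^ 2 * (-1) / ν = tk k := by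
    intro k
    rw [hc2]
    field_simp
    ring
  -- Step 2: the zoomed, viscosity-normalised data
  obtain ⟨C₀, A, w, pw, g, hC₀, hA, -, hclw, hIw, hmildw, hgw, hgb, hfreq, hpin⟩ :=
    hullTransfer_zoomData hν hT hcl hLH htuT hI ht₀ hK hGb hpinch hc hc0
  -- Step 3a: `C²_loc` extraction; the limit is a Type-I ancient MILD field
  have hcont : ∀ k, ContinuousOn (uncurry (w k)) (Ioo (A k) 0 ×ˢ univ) := fun k =>
    (hclw k).smooth_velocity.continuousOn.mono (prod_mono Ioo_subset_Ico_self Subset.rfl)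
  have hwdf : ∀ k, ∀ t ∈ Ioo (A k) 0, IsWeaklyDivFree (w k t) := fun k t ht =>
    VectorCalculus.IsDivFree.isWeaklyDivFree_holds ((hclw k).divFree t (Ioo_subset_Ico_self ht))
      (contDiff_infty.1 ((hclw k).contDiff_velocity (Ioo_subset_Ico_self ht)) 1)
  obtain ⟨φ, hφ, W, hW, hW0, hW1, hW2⟩ :=
    exists_tendsto_of_typeI_oseenMild_windows hC₀ hA hcont hwdf hmildw hIw
  -- Step 3b: kernel stability along the subsequence
  have hφt : Tendsto φ atTop atTop := hφ.tendsto_atTop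
  have ha₁' : 0 < a₁ * ν ^ ((3:ℝ) / 2) := mul_pos ha₁ (Real.rpow_pos_of_pos hν _)
  have hA₁' : 0 < A₁ * ν ^ ((3:ℝ) / 2) := mul_pos hA₁ (Real.rpow_pos_of_pos hν _)
  have ha₂' : 0 < a₂ / ν := div_pos ha₂ hν
  have hA₂' : 0 < A₂ / ν := div_pos hA₂ hν
  obtain ⟨ψ, hψ, K, hKc, hKeq, hgK⟩ := kernelStability C₀ (a₁ * ν ^ ((3:ℝ) / 2)) (a₂ / ν)
    (A₁ * ν ^ ((3:ℝ) / 2)) (A₂ / ν) (A ∘ φ) (fun k => w (φ k)) (fun k => pw (φ k))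
    (fun k => g (φ k)) W hC₀ ha₁' ha₂' hA₁' hA₂' (hA.comp hφt) (fun k => hclw (φ k))
    (fun k => hIw (φ k)) (fun k => hmildw (φ k)) (fun k => hgw (φ k)) (fun k => hgb (φ k))
    hW hW0 hW1 hW2
  have hψt : Tendsto ψ atTop atTop := hψ.tendsto_atTop
  have hφψt : Tendsto (fun j => φ (ψ j)) atTop atTop := hφt.comp hψt
  obtain ⟨hKW, hKb⟩ := isAdaptedBackwardKernel_of_limit (g := fun j => g (φ (ψ j)))
    (A := fun j => A (φ (ψ j))) (hA.comp hφψt) (fun j => (hgw _).integral_eq_one)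
    (fun j t ht => ((hgw _).contDiff_slice ht).continuous) ha₁' hA₂'
    (fun j => hgb (φ (ψ j))) hKc hKeq hgK
  -- Step 3c: one pressure for the tangent flow
  obtain ⟨q, hWcl⟩ := exists_isClassicalNSSolutionOn_Iio_of_isTypeIAncientMild hW
  -- Step 3d: the limit kernel is Gaussian comparable, hence unique among such
  have hKcmp : IsGaussianComparable K (Iio 0) 0 0 :=
    isGaussianComparable_iff_fin_three.2
      ⟨a₁ * ν ^ ((3:ℝ) / 2), a₂ / ν, A₁ * ν ^ ((3:ℝ) / 2), A₂ / ν, ha₁', ha₂', hA₁', hA₂', hKb⟩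
  have huniq : ∀ K' : ℝ → EuclideanSpace ℝ (Fin 3) → ℝ, IsAdaptedBackwardKernel 1 W (Iio 0) 0 0 K' →
      IsGaussianComparable K' (Iio 0) 0 0 → ∀ t ∈ Iio (0:ℝ), K' t = K t := by
    intro K' hK' hK'c
    refine stub_doeblin stub_katoL1 stub_blockSolver 1 C₀ 0 (Iio 0) one_pos Subset.rfl
      (fun t _ => Ico_subset_Iio_self) W hWcl.smooth_velocity hWcl.divFree ?_ 0 K' K hK' hK'c
      hKW hKcmp
    intro t ht x
    simpa using hW.norm_le (t := t) ht x
  -- Step 4a: limits of `H_k(τ)` and `Λ_k(τ)` along `j ↦ φ (ψ j)`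
  have hlim := fun (τ : ℝ) (hτ : τ < 0) =>
    hullTransfer_tendsto_enstrophy_frequency hC₀ (hA.comp hφψt) (fun k => hclw (φ (ψ k)))
      (fun k => hmildw (φ (ψ k))) (fun k => hIw (φ (ψ k))) (fun k => hgw (φ (ψ k))) hA₁'.le hA₂'
      (fun k t ht x => (hgb (φ (ψ k)) t ht x).2) hWcl hKW
      (fun t ht x => (tendsto_at_of_tendstoLocallyUniformly (hW1 t ht) x).comp hψt)
      (fun t ht x => (tendsto_at_of_tendstoLocallyUniformly (hW2 t ht) x).comp hψt) hgK hτ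
  -- Step 4b: the limit pair is pinched
  have hpinW : ∀ τ < 0, c₀ ≤ (-τ) ^ 2 * adaptedEnstrophy W K τ ∧
      (-τ) ^ 2 * adaptedEnstrophy W K τ ≤ C₁ := by
    intro τ hτ
    have hH := ((hlim τ hτ).1).const_mul ((-τ) ^ 2)
    have hev : ∀ᶠ j in atTop, t₁ ≤ T + c (φ (ψ j)) ^ 2 * τ / ν := by
      have h1 : Tendsto (fun j => T + c (φ (ψ j)) ^ 2 * τ / ν) atTop
          (𝓝 (T + 0 ^ 2 * τ / ν)) :=
        tendsto_const_nhds.add ((((hc0.comp hφψt).pow 2).mul_const τ).div_const ν)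
      rw [zero_pow two_ne_zero, zero_mul, zero_div, add_zero] at h1
      exact (h1.eventually (eventually_gt_nhds ht₁.2)).mono fun j hj => hj.le
    exact ⟨ge_of_tendsto hH (hev.mono fun j hj => (hpin _ τ hτ hj).1),
      le_of_tendsto hH (hev.mono fun j hj => (hpin _ τ hτ hj).2)⟩
  have hposW : ∀ τ < 0, 0 < adaptedEnstrophy W K τ := by
    intro τ hτ
    have h1 := (hpinW τ hτ).1
    have h2 : 0 < (-τ) ^ 2 := pow_pos (neg_pos.2 hτ) 2
    exact pos_of_mul_pos_right (hc₀.trans_le h1) h2.le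
  -- Step 4c: the frequency of the limit at `τ = -1` is a limit of `Λ(t_k)`, hence `≠ 2`
  have hΛ1 : Tendsto (fun j => adaptedFrequency (w (φ (ψ j))) (g (φ (ψ j))) 0 (-1)) atTop
      (𝓝 (adaptedFrequency W K 0 (-1))) :=
    (hlim (-1) (by norm_num)).2 (hposW (-1) (by norm_num)).ne'
  have hΛ1' : ∀ j, adaptedFrequency (w (φ (ψ j))) (g (φ (ψ j))) 0 (-1) =
      adaptedFrequency u G T (tk (φ (ψ j))) := by
    intro j
    rw [hfreq, hzoom1]
  have hfar : ε ≤ |adaptedFrequency W K 0 (-1) - 2| := by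
    have hc' := (continuous_abs.tendsto _).comp (hΛ1.sub_const 2)
    refine ge_of_tendsto hc' (Eventually.of_forall fun j => ?_)
    simp only [Function.comp]
    rw [hΛ1']
    exact hΛε _
  have hne2 : adaptedFrequency W K 0 (-1) ≠ 2 := by
    intro h
    rw [h, sub_self, abs_zero] at hfar
    linarith
  -- Step 5: `h̄` is not constant
  have hnc : ∃ τ₁ τ₂ : ℝ, τ₁ < 0 ∧ τ₂ < 0 ∧
      (-τ₁) ^ 2 * adaptedEnstrophy W K τ₁ ≠ (-τ₂) ^ 2 * adaptedEnstrophy W K τ₂ := by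
    by_contra hall
    push Not at hall
    apply hne2
    rw [adaptedFrequency_apply]
    exact hullTransfer_frequency_two_of_const (adaptedEnstrophy W K)
      (hposW (-1) (by norm_num)).ne' hall
  exact ⟨C₀, W, K, hC₀, hW, ⟨q, hWcl⟩, hKW, hKb, huniq, fun τ hτ => hpinW τ hτ, hne2, hnc⟩

/-- **The crux follows from h-stationarity of pinched unit-viscosity Type-I ancient MILD pairs**
(sharpened K2 form of the crux chain). Hypothesis: every pair `(W, K)` with `W ∈ IsTypeIAncientMild C₀`
(unit viscosity, Oseen/KNSS gauge on `ℝ³ × (−∞,0)`, `‖W(t,x)‖ ≤ C₀/√(−t)`), `K` an adapted kernel of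
`W` on `(−∞,0)` with pole `(0,0)`, Gaussian-comparable and unique among such, whose rescaled adapted
enstrophy `(−τ)²·adaptedEnstrophy W K τ` is pinched in `[c, C']`, `c > 0`, has it CONSTANT on
`(−∞,0)`. Conclusion: `AdaptedFrequencyConverges` (at every viscosity `ν > 0`). Proof: if `Λ` had no
limit at a Type-I singular point, the landed two-sided pinching (`stub_pinchingLower`,
`stub_pinchingUpper`) and `hullTransfer_mild_unit` produce such a pair with NON-constant `h̄`.
[folklore] -/
theorem adaptedFrequencyConverges_of_pinchedMildHullHStationary :
    (∀ (C₀ c C' : ℝ) (W : ℝ → (EuclideanSpace ℝ (Fin 3)) → (EuclideanSpace ℝ (Fin 3))) (K : ℝ → (EuclideanSpace ℝ (Fin 3)) → ℝ), 0 ≤ C₀ → 0 < c → IsTypeIAncientMild C₀ W → IsAdaptedBackwardKernel 1 W (Iio 0) 0 0 K → IsGaussianComparable K (Iio 0) 0 0 → (∀ K' : ℝ → (EuclideanSpace ℝ (Fin 3)) → ℝ, IsAdaptedBackwardKernel 1 W (Iio 0) 0 0 K' → IsGaussianComparable K' (Iio 0) 0 0 → ∀ t ∈ Iio (0:ℝ),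 K' t = K t) → (∀ τ ∈ Iio (0:ℝ), c ≤ (-τ) ^ 2 * adaptedEnstrophy W K τ ∧ (-τ) ^ 2 * adaptedEnstrophy W K τ ≤ C') → ∀ τ₁ τ₂ : ℝ, τ₁ < 0 → τ₂ < 0 → (-τ₁) ^ 2 * adaptedEnstrophy W K τ₁ = (-τ₂) ^ 2 * adaptedEnstrophy W K τ₂) →
    AdaptedFrequencyConverges := by
  intro hstat ν T hν hT u p hcl hLH hdec hTI x₀ t₀ G ht₀ hsing hK hcomp H Λ hH hΛ
  have hker : IsAdaptedBackwardKernel ν u (Ico t₀ T) T x₀ G := isAdaptedBackwardKernel_iff.2 hK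
  have hcmp : IsGaussianComparable G (Ico t₀ T) T x₀ := isGaussianComparable_iff_fin_three.2 hcomp
  -- `H` is the adapted enstrophy, `Λ` the adapted frequency
  have hH' : H = adaptedEnstrophy u G := by
    rw [hH]; funext t; rfl
  have hΛ' : Λ = adaptedFrequency u G T := by
    rw [hΛ, hH']; funext t; rfl
  rw [hΛ']
  by_contra hnot
  -- pinching near `T` on a common window `[t₁, T)` (landed stubs of line tauberian-omega-limit)
  obtain ⟨t₂, ht₂, C₁, hup⟩ :=
    TauberianOmegaLimit.stub_pinchingUpper ν T u p x₀ t₀ G hν hT hcl hLH hdec hTI ht₀ hsing hker hcmp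
  obtain ⟨t₂', ht₂', c₀, hc₀, hlow⟩ :=
    TauberianOmegaLimit.stub_pinchingLower ν T u p x₀ t₀ G hν hT hcl hLH hdec hTI ht₀ hsing hker hcmp
  set t₁ : ℝ := max t₂ t₂' with ht₁
  have ht₁mem : t₁ ∈ Ico t₀ T :=
    ⟨ht₂.1.trans (le_max_left _ _), max_lt ht₂.2 ht₂'.2⟩
  have hpinch : ∀ t ∈ Ico t₁ T,
      c₀ ≤ (T - t) ^ 2 * adaptedEnstrophy u G t ∧ (T - t) ^ 2 * adaptedEnstrophy u G t ≤ C₁ :=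
    fun t ht => ⟨hlow t ⟨(le_max_right _ _).trans ht.1, ht.2⟩,
      hup t ⟨(le_max_left _ _).trans ht.1, ht.2⟩⟩
  -- the Gaussian constants of `G`
  obtain ⟨a₁, a₂, A₁, A₂, ha₁, ha₂, hA₁, hA₂, hGb⟩ := isGaussianComparable_iff_fin_three.1 hcmp
  -- the pinched unit-viscosity Type-I ancient mild pair with unique kernel and non-constant `h̄`
  obtain ⟨C₀, W, K, hC₀, hW, -, hKW, hKb, huniq, hpin, -, τ₁, τ₂, hτ₁, hτ₂, hne⟩ :=
    hullTransfer_mild_unit hν hT hcl hLH hTI ht₀ hker ha₁ ha₂ hA₁ hA₂ hGb ht₁mem hc₀ hpinch hnot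
  have ha₁' : 0 < a₁ * ν ^ ((3:ℝ) / 2) := mul_pos ha₁ (Real.rpow_pos_of_pos hν _)
  have hA₁' : 0 < A₁ * ν ^ ((3:ℝ) / 2) := mul_pos hA₁ (Real.rpow_pos_of_pos hν _)
  have ha₂' : 0 < a₂ / ν := div_pos ha₂ hν
  have hA₂' : 0 < A₂ / ν := div_pos hA₂ hν
  have hKcmp : IsGaussianComparable K (Iio 0) 0 0 :=
    isGaussianComparable_iff_fin_three.2
      ⟨a₁ * ν ^ ((3:ℝ) / 2), a₂ / ν, A₁ * ν ^ ((3:ℝ) / 2), A₂ / ν, ha₁', ha₂', hA₁', hA₂', hKb⟩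
  exact hne (hstat C₀ c₀ C₁ W K hC₀ hc₀ hW hKW hKcmp huniq hpin τ₁ τ₂ hτ₁ hτ₂)

end Summit.NavierStokesRegularity.NavierStokesRegularity.Theorems.AdaptedFrequencyConverges.CloudFrameEffectiveTsai

end
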